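import Summits.AtomisticToContinuum.Crystallization.Theorems.FrustratedLawDichotomyCellArithLip

/-!
# FrustratedLawDichotomy · crux `AperiodicFrustratedLawGap` (stmt-AtomisticToContinuum-27623) — CELL-ARITH «NASH-LIP», the per-label packaging:
# NASH number = CENTRE value + ε·Lipschitz slack (decomp-a2c hand-1 g53; sequel of `…CellArithLip`; critic r1796 (B))

Layout-free (over (252)'s own near sets), real side; the K-file supplies rational tables and decides the one comparison.
* ★ `nash_centre_lip_coord` — for `|G − 1| ≤ ε` and every pair's `g_G(z,z)`, `|z|²` in its class window:
  `|(nashVecLab G … m) i − (nashVecLab 1 … m) i| ≤ ε·(lead_i + [m ∈ MI]·Σ_{own pairs} lip_i + Σ_{neighbour pairs} lip_i)` with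
  `lead_i = Ψ₁·|a m|₁²·|a m i|` and `lip_i(z, y) = Ψ₁|z|₁²|y i| + 2|z i|(|z|₁|y|₁Ψ₁ + |z·y|Ψ₂|z|₁²)` (`…CellArithLip.abs_linLab_sub_linLab_one_le`);
* ★ `norm_posL_le_of_centre_lip` — from coordinate bounds `|v i − v₀ i| ≤ ε·L i`, centre bounds `|v₀ i| ≤ V i` and ONE rational comparison
  `(1 + 3ε)·Σ_i (V i + ε·L i)² ≤ b²` (`0 ≤ b`): `‖posL F v‖ ≤ b` ((260) `norm_le_of_nearId`) — with `v = nashVecLab G …` and (252) `nashVec_posL`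
  this is the (251) `hnn` entry in the centre-plus-slack currency.
DEF-FREE; imports `…CellArithLip`; 0 sorry.  Tags: [folklore].
-/

noncomputable section

namespace Summit.AtomisticToContinuum.Crystallization.Theorems.FrustratedLawDichotomyCellArithLipNash

open scoped BigOperators
open Summit.AtomisticToContinuum.Crystallization.Theorems.FrustratedLawDichotomyCoherentFloorAlgebra (psiT psiT1)
open Summit.AtomisticToContinuum.Crystallization.Theorems.FrustratedLawDichotomyCellMetric (posL gram linLab nashVecLab)
open Summit.AtomisticToContinuum.Crystallization.Theorems.FrustratedLawDichotomyCellData (norm_le_of_nearId)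
open Summit.AtomisticToContinuum.Crystallization.Theorems.FrustratedLawDichotomyCellArithNashInt (abs_gram_sub_dot_le)
open Summit.AtomisticToContinuum.Crystallization.Theorems.FrustratedLawDichotomyCellArithLip

variable {ι : Type*} [DecidableEq ι]

/-- the Lipschitz bracket of one pair in coordinate `i` (the right-hand side of `abs_linLab_sub_linLab_one_le` without the factor `ε`). -/
def lipCoef (lo hi : ℝ) (z y : Fin 3 → ℝ) (i : Fin 3) : ℝ :=
  max (-(-4 * lo⁻¹ ^ 5 + 7 * hi⁻¹ ^ 8)) (-4 * hi⁻¹ ^ 5 + 7 * lo⁻¹ ^ 8) * (∑ j, |z j|) ^ 2 * |y i|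
    + 2 * |z i| * ((∑ j, |z j|) * (∑ j, |y j|) * max (-(-4 * lo⁻¹ ^ 5 + 7 * hi⁻¹ ^ 8)) (-4 * hi⁻¹ ^ 5 + 7 * lo⁻¹ ^ 8)
      + |∑ j, z j * y j| * max (-(20 * hi⁻¹ ^ 6 - 56 * lo⁻¹ ^ 9)) (20 * lo⁻¹ ^ 6 - 56 * hi⁻¹ ^ 9) * (∑ j, |z j|) ^ 2)

/-- the lead bracket `Ψ₁·|a|₁²·|a i|` (for `ψ(g(a,a))·a i`). -/
def leadCoef (lo hi : ℝ) (a : Fin 3 → ℝ) (i : Fin 3) : ℝ :=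
  max (-(-4 * lo⁻¹ ^ 5 + 7 * hi⁻¹ ^ 8)) (-4 * hi⁻¹ ^ 5 + 7 * lo⁻¹ ^ 8) * (∑ j, |a j|) ^ 2 * |a i|

section Centre

variable {G : Matrix (Fin 3) (Fin 3) ℝ} {ε : ℝ} {M MI : Finset ι} {nb : ι → Finset ι} {m : ι} {i : Fin 3}
  {a ω : ι → Fin 3 → ℝ} {lo0 hi0 : ℝ} {tlo thi tlo' thi' : ι → ℝ}

omit [DecidableEq ι] in
/-- the lead term: `|ψ(g_G(a,a))·a i − ψ(|a|²)·a i| ≤ ε·leadCoef`. [folklore] -/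
theorem abs_lead_sub_le (hG : ∀ i j, |G i j - (if i = j then 1 else 0)| ≤ ε) (v : Fin 3 → ℝ) (i : Fin 3) {lo hi : ℝ}
    (h0 : 0 < lo) (h1 : lo ≤ gram G v v) (h2 : gram G v v ≤ hi) (h1' : lo ≤ ∑ j, v j * v j) (h2' : ∑ j, v j * v j ≤ hi) :
    |(psiT (gram G v v) • v) i - (psiT (gram 1 v v) • v) i| ≤ ε * leadCoef lo hi v i := by
  have dt : |gram G v v - ∑ j, v j * v j| ≤ ε * ((∑ j, |v j|) * (∑ j, |v j|)) := abs_gram_sub_dot_le hG v v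
  have dψ := abs_psiT_sub_le h0 h1' h2' h1 h2
  have hΨ : 0 ≤ max (-(-4 * lo⁻¹ ^ 5 + 7 * hi⁻¹ ^ 8)) (-4 * hi⁻¹ ^ 5 + 7 * lo⁻¹ ^ 8) :=
    (abs_nonneg _).trans (Summit.AtomisticToContinuum.Crystallization.Theorems.FrustratedLawDichotomyCellEnclosures.abs_psiT1_le h0 h1 h2)
  simp only [Pi.smul_apply, smul_eq_mul, gram_one]
  rw [← sub_mul, abs_mul]
  unfold leadCoef
  have := mul_le_mul_of_nonneg_left dt hΨ
  have h3 : |psiT (gram G v v) - psiT (∑ j, v j * v j)| * |v i|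
      ≤ (max (-(-4 * lo⁻¹ ^ 5 + 7 * hi⁻¹ ^ 8)) (-4 * hi⁻¹ ^ 5 + 7 * lo⁻¹ ^ 8) * (ε * ((∑ j, |v j|) * (∑ j, |v j|)))) * |v i| :=
    mul_le_mul_of_nonneg_right (dψ.trans this) (abs_nonneg _)
  refine h3.trans (le_of_eq ?_)
  ring

/-- ★ CENTRE-PLUS-SLACK, coordinate form: the NASH residual vector moves from its centre value by at most `ε·(lead + own + neighbour
brackets)` in coordinate `i`. Windows: `lo0/hi0` for `g(a m, a m)` and `|a m|²`; `tlo/thi m'` for the own pairs `z = a m − a m'`; `tlo'/thi' x`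
for the neighbour pairs `z = a x − a m` (each window must contain both `g_G(z,z)` and `|z|²`). [folklore] -/
theorem nash_centre_lip_coord (hG : ∀ i j, |G i j - (if i = j then 1 else 0)| ≤ ε)
    (h0 : 0 < lo0) (h01 : lo0 ≤ gram G (a m) (a m)) (h02 : gram G (a m) (a m) ≤ hi0)
    (h01' : lo0 ≤ ∑ j, a m j * a m j) (h02' : ∑ j, a m j * a m j ≤ hi0)
    (hown : ∀ m' ∈ (M.erase m).filter (fun m' => m' ∈ nb m),
      0 < tlo m' ∧ tlo m' ≤ gram G (a m - a m') (a m - a m') ∧ gram G (a m - a m') (a m - a m') ≤ thi m'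
        ∧ tlo m' ≤ ∑ j, (a m - a m') j * (a m - a m') j ∧ ∑ j, (a m - a m') j * (a m - a m') j ≤ thi m')
    (hnbr : ∀ x ∈ (MI.erase m).filter (fun x => x ∈ nb m),
      0 < tlo' x ∧ tlo' x ≤ gram G (a x - a m) (a x - a m) ∧ gram G (a x - a m) (a x - a m) ≤ thi' x
        ∧ tlo' x ≤ ∑ j, (a x - a m) j * (a x - a m) j ∧ ∑ j, (a x - a m) j * (a x - a m) j ≤ thi' x) :
    |nashVecLab G M MI a ω nb m i - nashVecLab 1 M MI a ω nb m i|
      ≤ ε * (leadCoef lo0 hi0 (a m) i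
          + (if m ∈ MI then ∑ m' ∈ (M.erase m).filter (fun m' => m' ∈ nb m), lipCoef (tlo m') (thi m') (a m - a m') (ω m) i else 0)
          + ∑ x ∈ (MI.erase m).filter (fun x => x ∈ nb m), lipCoef (tlo' x) (thi' x) (a x - a m) (ω x) i) := by
  -- per pair
  have A : ∀ m' ∈ (M.erase m).filter (fun m' => m' ∈ nb m),
      |linLab G (a m - a m') (ω m) i - linLab 1 (a m - a m') (ω m) i| ≤ ε * lipCoef (tlo m') (thi m') (a m - a m') (ω m) i := by
    intro m' hm'
    obtain ⟨t0, t1, t2, t1', t2'⟩ := hown m' hm'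
    exact abs_linLab_sub_linLab_one_le hG (a m - a m') (ω m) i t0 t1 t2 t1' t2'
  have B : ∀ x ∈ (MI.erase m).filter (fun x => x ∈ nb m),
      |linLab G (a x - a m) (ω x) i - linLab 1 (a x - a m) (ω x) i| ≤ ε * lipCoef (tlo' x) (thi' x) (a x - a m) (ω x) i := by
    intro x hx
    obtain ⟨t0, t1, t2, t1', t2'⟩ := hnbr x hx
    exact abs_linLab_sub_linLab_one_le hG (a x - a m) (ω x) i t0 t1 t2 t1' t2'
  have L := abs_lead_sub_le hG (a m) i h0 h01 h02 h01' h02'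
  -- sums of coordinate differences
  have SA : |(∑ m' ∈ (M.erase m).filter (fun m' => m' ∈ nb m), linLab G (a m - a m') (ω m)) i
        - (∑ m' ∈ (M.erase m).filter (fun m' => m' ∈ nb m), linLab 1 (a m - a m') (ω m)) i|
      ≤ ε * ∑ m' ∈ (M.erase m).filter (fun m' => m' ∈ nb m), lipCoef (tlo m') (thi m') (a m - a m') (ω m) i := by
    rw [Finset.sum_apply, Finset.sum_apply, ← Finset.sum_sub_distrib, Finset.mul_sum]
    exact (Finset.abs_sum_le_sum_abs _ _).trans (Finset.sum_le_sum A)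
  have SB : |(∑ x ∈ (MI.erase m).filter (fun x => x ∈ nb m), linLab G (a x - a m) (ω x)) i
        - (∑ x ∈ (MI.erase m).filter (fun x => x ∈ nb m), linLab 1 (a x - a m) (ω x)) i|
      ≤ ε * ∑ x ∈ (MI.erase m).filter (fun x => x ∈ nb m), lipCoef (tlo' x) (thi' x) (a x - a m) (ω x) i := by
    rw [Finset.sum_apply, Finset.sum_apply, ← Finset.sum_sub_distrib, Finset.mul_sum]
    exact (Finset.abs_sum_le_sum_abs _ _).trans (Finset.sum_le_sum B)
  -- assemble: the difference splits into lead, own-sum and neighbour-sum differences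
  have e : nashVecLab G M MI a ω nb m i - nashVecLab 1 M MI a ω nb m i
      = ((psiT (gram G (a m) (a m)) • a m) i - (psiT (gram 1 (a m) (a m)) • a m) i)
        - ((if m ∈ MI then (∑ m' ∈ (M.erase m).filter (fun m' => m' ∈ nb m), linLab G (a m - a m') (ω m)) i else 0)
          - (if m ∈ MI then (∑ m' ∈ (M.erase m).filter (fun m' => m' ∈ nb m), linLab 1 (a m - a m') (ω m)) i else 0))
        + ((∑ x ∈ (MI.erase m).filter (fun x => x ∈ nb m), linLab G (a x - a m) (ω x)) i
          - (∑ x ∈ (MI.erase m).filter (fun x => x ∈ nb m), linLab 1 (a x - a m) (ω x)) i) := by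
    unfold nashVecLab
    by_cases hMI : m ∈ MI
    · simp only [hMI, if_true, Pi.sub_apply]; ring
    · simp only [hMI, if_false, Pi.sub_apply, Pi.zero_apply]; ring
  rw [e]
  have I : |(if m ∈ MI then (∑ m' ∈ (M.erase m).filter (fun m' => m' ∈ nb m), linLab G (a m - a m') (ω m)) i else 0)
        - (if m ∈ MI then (∑ m' ∈ (M.erase m).filter (fun m' => m' ∈ nb m), linLab 1 (a m - a m') (ω m)) i else 0)|
      ≤ ε * (if m ∈ MI then ∑ m' ∈ (M.erase m).filter (fun m' => m' ∈ nb m), lipCoef (tlo m') (thi m') (a m - a m') (ω m) i else 0) := by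
    by_cases hMI : m ∈ MI
    · simp only [hMI, if_true]; exact SA
    · simp only [hMI, if_false, sub_zero, abs_zero, mul_zero]; exact le_rfl
  calc |((psiT (gram G (a m) (a m)) • a m) i - (psiT (gram 1 (a m) (a m)) • a m) i)
        - ((if m ∈ MI then (∑ m' ∈ (M.erase m).filter (fun m' => m' ∈ nb m), linLab G (a m - a m') (ω m)) i else 0)
          - (if m ∈ MI then (∑ m' ∈ (M.erase m).filter (fun m' => m' ∈ nb m), linLab 1 (a m - a m') (ω m)) i else 0))
        + ((∑ x ∈ (MI.erase m).filter (fun x => x ∈ nb m), linLab G (a x - a m) (ω x)) i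
          - (∑ x ∈ (MI.erase m).filter (fun x => x ∈ nb m), linLab 1 (a x - a m) (ω x)) i)|
      ≤ |(psiT (gram G (a m) (a m)) • a m) i - (psiT (gram 1 (a m) (a m)) • a m) i|
        + |(if m ∈ MI then (∑ m' ∈ (M.erase m).filter (fun m' => m' ∈ nb m), linLab G (a m - a m') (ω m)) i else 0)
          - (if m ∈ MI then (∑ m' ∈ (M.erase m).filter (fun m' => m' ∈ nb m), linLab 1 (a m - a m') (ω m)) i else 0)|
        + |(∑ x ∈ (MI.erase m).filter (fun x => x ∈ nb m), linLab G (a x - a m) (ω x)) i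
          - (∑ x ∈ (MI.erase m).filter (fun x => x ∈ nb m), linLab 1 (a x - a m) (ω x)) i| := by
        refine (abs_add_le _ _).trans (add_le_add (abs_sub _ _) le_rfl)
    _ ≤ ε * leadCoef lo0 hi0 (a m) i
        + ε * (if m ∈ MI then ∑ m' ∈ (M.erase m).filter (fun m' => m' ∈ nb m), lipCoef (tlo m') (thi m') (a m - a m') (ω m) i else 0)
        + ε * ∑ x ∈ (MI.erase m).filter (fun x => x ∈ nb m), lipCoef (tlo' x) (thi' x) (a x - a m) (ω x) i :=
        add_le_add (add_le_add L I) SB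
    _ = _ := by ring

end Centre

/-- ★ THE NORM STEP of the centre-plus-slack currency: coordinate slacks `|v i − v₀ i| ≤ ε·L i`, centre bounds `|v₀ i| ≤ V i`, and ONE
rational comparison `(1 + 3ε)·Σ_i (V i + ε·L i)² ≤ b²`, `0 ≤ b` ⇒ `‖posL F v‖ ≤ b` on the near-identity box. [folklore] -/
theorem norm_posL_le_of_centre_lip {F : Matrix (Fin 3) (Fin 3) ℝ} {ε : ℝ}
    (hG : ∀ i j, |(F.transpose * F) i j - (if i = j then 1 else 0)| ≤ ε) (hε : 0 ≤ ε) {v v₀ L V : Fin 3 → ℝ} {b : ℝ}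
    (hd : ∀ i, |v i - v₀ i| ≤ ε * L i) (hV : ∀ i, |v₀ i| ≤ V i) (hb : 0 ≤ b)
    (hcmp : (1 + 3 * ε) * ∑ i, (V i + ε * L i) ^ 2 ≤ b ^ 2) : ‖posL F v‖ ≤ b := by
  refine norm_le_of_nearId hG hb (le_trans ?_ hcmp)
  refine mul_le_mul_of_nonneg_left (Finset.sum_le_sum fun i _ => ?_) (by linarith)
  have h1 : |v i| ≤ V i + ε * L i := by
    have := abs_sub_abs_le_abs_sub (v i) (v₀ i)
    linarith [hd i, hV i]
  have h0 : 0 ≤ V i + ε * L i := (abs_nonneg _).trans h1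
  calc v i ^ 2 = |v i| ^ 2 := (sq_abs _).symm
    _ ≤ (V i + ε * L i) ^ 2 := pow_le_pow_left₀ (abs_nonneg _) h1 2

end Summit.AtomisticToContinuum.Crystallization.Theorems.FrustratedLawDichotomyCellArithLipNash

end
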